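import Mathlib
import Summits.Ventures.PercRepro2.Defs
import Summits.Ventures.PercRepro2.Graph
import Summits.Ventures.PercRepro2.OneColourSwitch
import Summits.Ventures.PercRepro2.RegionHubSign

/-!
# Side switches of the two-colour world of a pair (blind cell PercRepro2, p3 g18, 2026-08-27;
`proofs/P3-CPNC.md` §15a–b)

For a uniform 2-colouring `ω` of a finite multigraph with marks `p, q, r, s` let
`K₂ = C_Y(r) ∪ C_Y(s)` and `M₂ = C_W(r) ∪ C_W(s)` be the two one-colour worlds of `{r, s}`, and
`Sep` the two-colour separation `p, q ∉ K₂ ∪ M₂` (`sep2`).  When no two non-marks are adjacent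
(`NoNonmarkEdge`), flipping every edge touching a set `C ⊆ (K₂ ∪ M₂) ∖ {r, s}` («side switch»,
`flipTouch`) is again a `Sep`-colouring in which the sides of `C` are exchanged:
`K₂(ω ⊕ touches C) = (K₂ ∖ C) ∪ (C ∩ M₂)` (`K2_flipTouch`, `M2_flipTouch`, `sep2_flipTouch`).
The proofs are closedness arguments (`mem_of_conn_of_closed`).  Own work; std axioms.
-/

namespace Summit.Ventures.PercRepro2

namespace SideSwitch

open Finset Classical RegionHub OneColourSwitch

variable {V : Type*} {E : Type*}
variable (ends : E → Sym2 V)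

/-- The `Y`-world of `{r, s}`: the union of the open clusters of `r` and `s`. -/
def K2 (r s : V) (ω : Config E) : Set V := expl ends ({r, s} : Set V) ω

/-- The `W`-world of `{r, s}`: the union of the closed clusters of `r` and `s`. -/
def M2 (r s : V) (ω : Config E) : Set V := expl ends ({r, s} : Set V) (OneColourSwitch.compl ω)

/-- A non-mark: a vertex other than `p, q, r, s`. -/
def Nonmark (p q r s x : V) : Prop := x ≠ p ∧ x ≠ q ∧ x ≠ r ∧ x ≠ s

/-- No edge joins two non-marks (loops at non-marks included). -/
def NoNonmarkEdge (p q r s : V) : Prop :=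
  ∀ e x y, ends e = s(x, y) → Nonmark p q r s x → Nonmark p q r s y → False

/-- No vertex other than `r, s` lies in both worlds of `{r, s}`. -/
def DZero (r s : V) (ω : Config E) : Prop :=
  ∀ x, x ≠ r → x ≠ s → x ∈ K2 ends r s ω → x ∉ M2 ends r s ω

variable {ends}

/-- Membership in the `Y`-world. -/
lemma mem_K2_iff {r s : V} {ω : Config E} {x : V} :
    x ∈ K2 ends r s ω ↔ Conn ends ω r x ∨ Conn ends ω s x := by
  simp only [K2, expl, Set.mem_setOf_eq, Set.mem_insert_iff, Set.mem_singleton_iff]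
  constructor
  · rintro ⟨h, (rfl | rfl), hc⟩
    · exact Or.inl hc
    · exact Or.inr hc
  · rintro (hc | hc)
    · exact ⟨r, Or.inl rfl, hc⟩
    · exact ⟨s, Or.inr rfl, hc⟩

/-- Membership in the `W`-world. -/
lemma mem_M2_iff {r s : V} {ω : Config E} {x : V} :
    x ∈ M2 ends r s ω ↔ Conn ends (OneColourSwitch.compl ω) r x ∨ Conn ends (OneColourSwitch.compl ω) s x :=
  mem_K2_iff (ends := ends) (ω := OneColourSwitch.compl ω)

/-- The `Y`-world of the flipped colouring is the `W`-world. -/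
lemma K2_compl (r s : V) (ω : Config E) : K2 ends r s (OneColourSwitch.compl ω) = M2 ends r s ω := rfl

/-- The `W`-world of the flipped colouring is the `Y`-world. -/
lemma M2_compl (r s : V) (ω : Config E) : M2 ends r s (OneColourSwitch.compl ω) = K2 ends r s ω := by
  simp only [M2, K2, OneColourSwitch.compl_compl]

/-- `r` lies in the `Y`-world. -/
lemma r_mem_K2 (r s : V) (ω : Config E) : r ∈ K2 ends r s ω :=
  mem_K2_iff.2 (Or.inl (conn_refl _ _ _))

/-- `s` lies in the `Y`-world. -/
lemma s_mem_K2 (r s : V) (ω : Config E) : s ∈ K2 ends r s ω :=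
  mem_K2_iff.2 (Or.inr (conn_refl _ _ _))

/-- `r` lies in the `W`-world. -/
lemma r_mem_M2 (r s : V) (ω : Config E) : r ∈ M2 ends r s ω := r_mem_K2 r s (OneColourSwitch.compl ω)

/-- `s` lies in the `W`-world. -/
lemma s_mem_M2 (r s : V) (ω : Config E) : s ∈ M2 ends r s ω := s_mem_K2 r s (OneColourSwitch.compl ω)

/-- `DZero` is invariant under the colour flip. -/
lemma DZero_compl {r s : V} {ω : Config E} (h : DZero ends r s ω) : DZero ends r s (OneColourSwitch.compl ω) := by
  intro x hr hs hx hM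
  rw [K2_compl] at hx
  rw [M2_compl] at hM
  exact h x hr hs hM hx

/-- Under `Sep`, `p` and `q` lie in neither world. -/
lemma not_mem_K2_of_sep2 {p q r s : V} {ω : Config E} (h : sep2 ends p q r s ω) :
    p ∉ K2 ends r s ω ∧ q ∉ K2 ends r s ω := by
  obtain ⟨⟨hpr, hps, hqr, hqs⟩, _⟩ := h
  constructor
  · intro hp
    rcases mem_K2_iff.1 hp with hc | hc
    · exact hpr (conn_symm hc)
    · exact hps (conn_symm hc)
  · intro hq
    rcases mem_K2_iff.1 hq with hc | hc
    · exact hqr (conn_symm hc)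
    · exact hqs (conn_symm hc)

/-- Under `Sep`, `p` and `q` lie outside the `W`-world. -/
lemma not_mem_M2_of_sep2 {p q r s : V} {ω : Config E} (h : sep2 ends p q r s ω) :
    p ∉ M2 ends r s ω ∧ q ∉ M2 ends r s ω :=
  not_mem_K2_of_sep2 (sep2_compl.2 h)

/-- The `Y`-world is closed under open edges. -/
lemma mem_K2_of_open {r s : V} {ω : Config E} {x y : V} {e : E} (hx : x ∈ K2 ends r s ω)
    (he : ω e = true) (hends : ends e = s(x, y)) : y ∈ K2 ends r s ω := by
  rcases mem_K2_iff.1 hx with hc | hc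
  · exact mem_K2_iff.2 (Or.inl (conn_trans hc (conn_of_openAdj ⟨e, he, hends⟩)))
  · exact mem_K2_iff.2 (Or.inr (conn_trans hc (conn_of_openAdj ⟨e, he, hends⟩)))

/-- The `W`-world is closed under closed edges. -/
lemma mem_M2_of_closed {r s : V} {ω : Config E} {x y : V} {e : E} (hx : x ∈ M2 ends r s ω)
    (he : ω e = false) (hends : ends e = s(x, y)) : y ∈ M2 ends r s ω :=
  mem_K2_of_open (ω := OneColourSwitch.compl ω) hx (by simp [OneColourSwitch.compl, he]) hends





/-- Under `Sep`, `r` has no edge to a vertex outside `U₂`. -/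
lemma not_edge_r_outside {p q r s : V} {ω : Config E} (_h : sep2 ends p q r s ω) {y : V} {e : E}
    (hyK : y ∉ K2 ends r s ω) (hyM : y ∉ M2 ends r s ω) (hends : ends e = s(r, y)) : False := by
  cases he : ω e
  · exact hyM (mem_M2_of_closed (r_mem_M2 r s ω) he hends)
  · exact hyK (mem_K2_of_open (r_mem_K2 r s ω) he hends)

/-- Under `Sep`, `s` has no edge to a vertex outside `U₂`. -/
lemma not_edge_s_outside {p q r s : V} {ω : Config E} (_h : sep2 ends p q r s ω) {y : V} {e : E}
    (hyK : y ∉ K2 ends r s ω) (hyM : y ∉ M2 ends r s ω) (hends : ends e = s(s, y)) : False := by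
  cases he : ω e
  · exact hyM (mem_M2_of_closed (s_mem_M2 r s ω) he hends)
  · exact hyK (mem_K2_of_open (s_mem_K2 r s ω) he hends)

/-! ## The side switch -/

/-- An edge with both endpoints outside `S` does not touch `S`. -/
lemma not_mem_touches_of_ends {S : Set V} {e : E} {x y : V} (h : ends e = s(x, y))
    (hx : x ∉ S) (hy : y ∉ S) : e ∉ touches ends S := by
  rintro ⟨z, hz, w, hzw⟩
  rw [h, Sym2.eq_iff] at hzw
  rcases hzw with ⟨rfl, _⟩ | ⟨_, rfl⟩
  · exact hx hz
  · exact hy hz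

/-- The colour flip commutes with `flipTouch`. -/
lemma compl_flipTouch (S : Set V) (ω : Config E) :
    OneColourSwitch.compl (flipTouch ends S ω) = flipTouch ends S (OneColourSwitch.compl ω) := by
  funext e
  by_cases h : e ∈ touches ends S
  · simp [OneColourSwitch.compl, flipTouch_of_mem ends h]
  · simp [OneColourSwitch.compl, flipTouch_of_notMem ends h]

/-- A vertex of `U₂` other than `r, s` is a non-mark (under `Sep`). -/
lemma nonmark_of_mem_U2 {p q r s : V} {ω : Config E} (h : sep2 ends p q r s ω) {x : V}
    (hx : x ∈ K2 ends r s ω ∪ M2 ends r s ω) (hr : x ≠ r) (hs : x ≠ s) : Nonmark p q r s x := by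
  obtain ⟨hpK, hqK⟩ := not_mem_K2_of_sep2 h
  obtain ⟨hpM, hqM⟩ := not_mem_M2_of_sep2 h
  refine ⟨?_, ?_, hr, hs⟩
  · rintro rfl
    rcases hx with hx | hx
    · exact hpK hx
    · exact hpM hx
  · rintro rfl
    rcases hx with hx | hx
    · exact hqK hx
    · exact hqM hx

/-- `Sep` in terms of the two worlds. -/
lemma sep2_iff {p q r s : V} {ω : Config E} :
    sep2 ends p q r s ω ↔
      (p ∉ K2 ends r s ω ∧ q ∉ K2 ends r s ω) ∧ (p ∉ M2 ends r s ω ∧ q ∉ M2 ends r s ω) := by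
  constructor
  · intro h
    exact ⟨not_mem_K2_of_sep2 h, not_mem_M2_of_sep2 h⟩
  · rintro ⟨⟨hpK, hqK⟩, ⟨hpM, hqM⟩⟩
    refine ⟨⟨?_, ?_, ?_, ?_⟩, ⟨?_, ?_, ?_, ?_⟩⟩
    · exact fun hc => hpK (mem_K2_iff.2 (Or.inl (conn_symm hc)))
    · exact fun hc => hpK (mem_K2_iff.2 (Or.inr (conn_symm hc)))
    · exact fun hc => hqK (mem_K2_iff.2 (Or.inl (conn_symm hc)))
    · exact fun hc => hqK (mem_K2_iff.2 (Or.inr (conn_symm hc)))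
    · exact fun hc => hpM (mem_M2_iff.2 (Or.inl (conn_symm hc)))
    · exact fun hc => hpM (mem_M2_iff.2 (Or.inr (conn_symm hc)))
    · exact fun hc => hqM (mem_M2_iff.2 (Or.inl (conn_symm hc)))
    · exact fun hc => hqM (mem_M2_iff.2 (Or.inr (conn_symm hc)))

/-- Every non-mark of the `W`-world is joined to `r` or `s` by a single closed edge (no two
non-marks are adjacent). -/
lemma exists_closed_edge_of_mem_M2 {p q r s : V} {ω : Config E} (hno : NoNonmarkEdge ends p q r s)
    (h : sep2 ends p q r s ω) {x : V} (hx : x ∈ M2 ends r s ω) (hr : x ≠ r) (hs : x ≠ s) :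
    ∃ m, (m = r ∨ m = s) ∧ ∃ e, ends e = s(m, x) ∧ ω e = false := by
  let Z : Set V := {y | y ∈ M2 ends r s ω →
    (y = r ∨ y = s ∨ ∃ m, (m = r ∨ m = s) ∧ ∃ e, ends e = s(m, y) ∧ ω e = false)}
  have hcl : ∀ y ∈ Z, ∀ z, (openGraph ends (OneColourSwitch.compl ω)).Adj y z → z ∈ Z := by
    intro y hy z hyz hzM
    obtain ⟨_, e, he, hends⟩ := openGraph_adj.1 hyz
    have he' : ω e = false := by
      simpa [OneColourSwitch.compl] using he
    have hyM : y ∈ M2 ends r s ω :=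
      mem_M2_of_closed hzM he' (by rw [hends, Sym2.eq_swap])
    by_cases hyr : y = r
    · exact Or.inr (Or.inr ⟨y, Or.inl hyr, e, hends, he'⟩)
    by_cases hys : y = s
    · exact Or.inr (Or.inr ⟨y, Or.inr hys, e, hends, he'⟩)
    by_cases hzr : z = r
    · exact Or.inl hzr
    by_cases hzs : z = s
    · exact Or.inr (Or.inl hzs)
    exact (hno e y z hends (nonmark_of_mem_U2 h (Or.inr hyM) hyr hys)
      (nonmark_of_mem_U2 h (Or.inr hzM) hzr hzs)).elim
  have hrZ : r ∈ Z := fun _ => Or.inl rfl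
  have hsZ : s ∈ Z := fun _ => Or.inr (Or.inl rfl)
  have hxZ : x ∈ Z := by
    rcases mem_M2_iff.1 hx with hc | hc
    · exact mem_of_conn_of_closed hcl hrZ hc
    · exact mem_of_conn_of_closed hcl hsZ hc
  rcases hxZ hx with h1 | h2 | h3
  · exact (hr h1).elim
  · exact (hs h2).elim
  · exact h3

/-- Every non-mark of the `Y`-world is joined to `r` or `s` by a single open edge. -/
lemma exists_open_edge_of_mem_K2 {p q r s : V} {ω : Config E} (hno : NoNonmarkEdge ends p q r s)
    (h : sep2 ends p q r s ω) {x : V} (hx : x ∈ K2 ends r s ω) (hr : x ≠ r) (hs : x ≠ s) :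
    ∃ m, (m = r ∨ m = s) ∧ ∃ e, ends e = s(m, x) ∧ ω e = true := by
  have hx' : x ∈ M2 ends r s (OneColourSwitch.compl ω) := by rw [M2_compl]; exact hx
  obtain ⟨m, hm, e, hends, he⟩ := exists_closed_edge_of_mem_M2 hno (sep2_compl.2 h) hx' hr hs
  refine ⟨m, hm, e, hends, ?_⟩
  simpa [OneColourSwitch.compl] using he

/-- **The side switch, `Y`-world**: flipping every edge touching a set `C ⊆ U₂ ∖ {r, s}` exchanges
the sides of `C`: `K₂(ω ⊕ touches C) = (K₂ ∖ C) ∪ (C ∩ M₂)`. -/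
theorem K2_flipTouch {p q r s : V} {ω : Config E} (hno : NoNonmarkEdge ends p q r s)
    (h : sep2 ends p q r s ω) {C : Set V} (hC : C ⊆ K2 ends r s ω ∪ M2 ends r s ω)
    (hCr : r ∉ C) (hCs : s ∉ C) :
    K2 ends r s (flipTouch ends C ω) = (K2 ends r s ω \ C) ∪ (C ∩ M2 ends r s ω) := by
  set ω' := flipTouch ends C ω with hω'
  have hnm : ∀ x ∈ C, Nonmark p q r s x := by
    intro x hx
    refine nonmark_of_mem_U2 h (hC hx) ?_ ?_
    · rintro rfl; exact hCr hx
    · rintro rfl; exact hCs hx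
  have hmem : ∀ {e : E}, e ∈ touches ends C → ω' e = !ω e := fun het => by
    rw [hω', flipTouch_of_mem ends het]
  have hnot : ∀ {e : E}, e ∉ touches ends C → ω' e = ω e := fun hnt => by
    rw [hω', flipTouch_of_notMem ends hnt]
  apply Set.Subset.antisymm
  · -- `S` is closed under open adjacency in `ω'` and contains `r, s`
    have hcl : ∀ x ∈ (K2 ends r s ω \ C) ∪ (C ∩ M2 ends r s ω), ∀ y,
        (openGraph ends ω').Adj x y → y ∈ (K2 ends r s ω \ C) ∪ (C ∩ M2 ends r s ω) := by
      intro x hx y hxy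
      obtain ⟨_, e, he, hends⟩ := openGraph_adj.1 hxy
      rcases hx with ⟨hxK, hxC⟩ | ⟨hxC, hxM⟩
      · by_cases hyC : y ∈ C
        · have het : e ∈ touches ends C := mem_touches_of_ends hends (Or.inr hyC)
          have he0 : ω e = false := by
            have := hmem het
            rw [he] at this
            simpa using this.symm
          -- `x` is `r` or `s`: a non-mark `x` would be adjacent to the non-mark `y`
          have hxrs : x = r ∨ x = s := by
            by_contra hx'
            exact hno e x y hends (nonmark_of_mem_U2 h (Or.inl hxK) (fun h1 => hx' (Or.inl h1))
              (fun h2 => hx' (Or.inr h2))) (hnm y hyC)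
          have hxM : x ∈ M2 ends r s ω := by
            rcases hxrs with rfl | rfl
            · exact r_mem_M2 _ _ ω
            · exact s_mem_M2 _ _ ω
          exact Or.inr ⟨hyC, mem_M2_of_closed hxM he0 hends⟩
        · have hnt : e ∉ touches ends C := not_mem_touches_of_ends hends hxC hyC
          have he1 : ω e = true := by rw [← hnot hnt]; exact he
          exact Or.inl ⟨mem_K2_of_open hxK he1 hends, hyC⟩
      · by_cases hyC : y ∈ C
        · exact (hno e x y hends (hnm x hxC) (hnm y hyC)).elim
        · have het : e ∈ touches ends C := mem_touches_of_ends hends (Or.inl hxC)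
          have he0 : ω e = false := by
            have := hmem het
            rw [he] at this
            simpa using this.symm
          have hyM : y ∈ M2 ends r s ω := mem_M2_of_closed hxM he0 hends
          by_cases hyK : y ∈ K2 ends r s ω
          · exact Or.inl ⟨hyK, hyC⟩
          · -- `y ∈ M₂ ∖ K₂` is a non-mark adjacent to the non-mark `x`
            have hyr : y ≠ r := by rintro rfl; exact hyK (r_mem_K2 _ _ ω)
            have hys : y ≠ s := by rintro rfl; exact hyK (s_mem_K2 _ _ ω)
            exact (hno e x y hends (hnm x hxC) (nonmark_of_mem_U2 h (Or.inr hyM) hyr hys)).elim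
    intro x hx
    rcases mem_K2_iff.1 hx with hc | hc
    · exact mem_of_conn_of_closed hcl (Or.inl ⟨r_mem_K2 r s ω, hCr⟩) hc
    · exact mem_of_conn_of_closed hcl (Or.inl ⟨s_mem_K2 r s ω, hCs⟩) hc
  · rintro x (⟨hxK, hxC⟩ | ⟨hxC, hxM⟩)
    · -- `K₂ ∖ C ⊆ K₂(ω')`: the set `K₂ᶜ ∪ K₂(ω') ∪ C` is closed in `ω`
      let Z : Set V := {y | y ∈ K2 ends r s ω → (y ∈ K2 ends r s ω' ∨ y ∈ C)}
      have hcl : ∀ y ∈ Z, ∀ z, (openGraph ends ω).Adj y z → z ∈ Z := by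
        intro y hy z hyz hzK
        obtain ⟨_, e, he, hends⟩ := openGraph_adj.1 hyz
        have hyK : y ∈ K2 ends r s ω := mem_K2_of_open hzK he (by rw [hends, Sym2.eq_swap])
        by_cases hzC : z ∈ C
        · exact Or.inr hzC
        have hzrs_of_yC : y ∈ C → z = r ∨ z = s := fun hyC => by
          by_contra hz'
          exact hno e y z hends (hnm y hyC) (nonmark_of_mem_U2 h (Or.inl hzK)
            (fun h1 => hz' (Or.inl h1)) (fun h2 => hz' (Or.inr h2)))
        by_cases hyC : y ∈ C
        · rcases hzrs_of_yC hyC with rfl | rfl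
          · exact Or.inl (r_mem_K2 _ _ _)
          · exact Or.inl (s_mem_K2 _ _ _)
        rcases hy hyK with hyK' | hyC'
        · have hnt : e ∉ touches ends C := not_mem_touches_of_ends hends hyC hzC
          have he1 : ω' e = true := by rw [hnot hnt]; exact he
          exact Or.inl (mem_K2_of_open hyK' he1 hends)
        · exact (hyC hyC').elim
      have hrZ : r ∈ Z := fun _ => Or.inl (r_mem_K2 _ _ _)
      have hsZ : s ∈ Z := fun _ => Or.inl (s_mem_K2 _ _ _)
      have hxZ : x ∈ Z := by
        rcases mem_K2_iff.1 hxK with hc | hc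
        · exact mem_of_conn_of_closed hcl hrZ hc
        · exact mem_of_conn_of_closed hcl hsZ hc
      rcases hxZ hxK with h1 | h1
      · exact h1
      · exact (hxC h1).elim
    · -- `C ∩ M₂ ⊆ K₂(ω')`: the closed edge from `r` or `s` to `x` becomes open
      have xr : x ≠ r := fun h' => hCr (h' ▸ hxC)
      have xs : x ≠ s := fun h' => hCs (h' ▸ hxC)
      obtain ⟨m, hm, e, hends, he0⟩ := exists_closed_edge_of_mem_M2 hno h hxM xr xs
      have het : e ∈ touches ends C := mem_touches_of_ends hends (Or.inr hxC)
      have he1 : ω' e = true := by rw [hmem het, he0]; rfl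
      rcases hm with rfl | rfl
      · exact mem_K2_iff.2 (Or.inl (conn_of_openAdj ⟨e, he1, hends⟩))
      · exact mem_K2_iff.2 (Or.inr (conn_of_openAdj ⟨e, he1, hends⟩))

/-- **The side switch, `W`-world**: `M₂(ω ⊕ touches C) = (M₂ ∖ C) ∪ (C ∩ K₂)`. -/
theorem M2_flipTouch {p q r s : V} {ω : Config E} (hno : NoNonmarkEdge ends p q r s)
    (h : sep2 ends p q r s ω) {C : Set V} (hC : C ⊆ K2 ends r s ω ∪ M2 ends r s ω)
    (hCr : r ∉ C) (hCs : s ∉ C) :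
    M2 ends r s (flipTouch ends C ω) = (M2 ends r s ω \ C) ∪ (C ∩ K2 ends r s ω) := by
  rw [M2, ← K2, compl_flipTouch]
  have hC' : C ⊆ K2 ends r s (OneColourSwitch.compl ω) ∪ M2 ends r s (OneColourSwitch.compl ω) := by
    rw [K2_compl, M2_compl]; exact fun x hx => (hC hx).symm
  rw [K2_flipTouch hno (sep2_compl.2 h) hC' hCr hCs, K2_compl, M2_compl]

/-- The side switch preserves `Sep`. -/
theorem sep2_flipTouch {p q r s : V} {ω : Config E} (hno : NoNonmarkEdge ends p q r s)
    (h : sep2 ends p q r s ω) {C : Set V} (hC : C ⊆ K2 ends r s ω ∪ M2 ends r s ω)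
    (hCr : r ∉ C) (hCs : s ∉ C) : sep2 ends p q r s (flipTouch ends C ω) := by
  have hK := K2_flipTouch hno h hC hCr hCs
  have hM := M2_flipTouch hno h hC hCr hCs
  obtain ⟨⟨hpK, hqK⟩, ⟨hpM, hqM⟩⟩ := sep2_iff.1 h
  have hpC : p ∉ C := fun hp => by
    rcases hC hp with h' | h'
    · exact hpK h'
    · exact hpM h'
  have hqC : q ∉ C := fun hq => by
    rcases hC hq with h' | h'
    · exact hqK h'
    · exact hqM h'
  rw [sep2_iff, hK, hM]
  refine ⟨⟨?_, ?_⟩, ⟨?_, ?_⟩⟩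
  · rintro (⟨h', _⟩ | ⟨h', _⟩)
    · exact hpK h'
    · exact hpC h'
  · rintro (⟨h', _⟩ | ⟨h', _⟩)
    · exact hqK h'
    · exact hqC h'
  · rintro (⟨h', _⟩ | ⟨h', _⟩)
    · exact hpM h'
    · exact hpC h'
  · rintro (⟨h', _⟩ | ⟨h', _⟩)
    · exact hqM h'
    · exact hqC h'


end SideSwitch

end Summit.Ventures.PercRepro2
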